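import Summits.AtomisticToContinuum.Crystallization.Theorems.FrustratedLawDichotomyExemptLocalSharp
import Summits.AtomisticToContinuum.Crystallization.Theorems.FrustratedLawDichotomyPeriodicBlockKernel

/-!
# FrustratedLawDichotomy · crux `AperiodicFrustratedLawGap` (stmt-AtomisticToContinuum-27623) — the MOTIF-LOCAL form of `(ε, ϱ, K)`-local
# optimality and its TRANSPORT to the interior sites of periodic blocks (the non-exemption hypothesis `hnex` of the X-kernel
# `…PeriodicBlockFlagsX.not_schurElasticPricingX_of_cell_strained_nonExempt` for the exemption of record `Ex = LocOptFails e⋆ ε ϱ K`)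
# (decomp-a2c, prover hand 2, structural share, generation 16; hand-2 g15 memo §2 / critic row 573 (C)(3))

`…ExemptLocal` / `…ExemptLocalSharp` localise the exemption in the POSITIVE direction (`ExchangeUnstableLoc (ε + 2K·T♯(D)) ⟹ ExchangeUnstable ε`:
a motif-local instability certifies the cluster-level exemption).  A periodic WITNESS against an X-law needs the opposite: its interior block sites
must be certified NON-exempt, i.e. `(ε, ϱ, K)`-locally OPTIMAL at `μ`, from data of the supercell motif only.

* §1 `LocOptLoc μ ε ϱ Rm K` — `…ExemptLocOpt.LocOpt` with the two fields `I(s, y∖s)`, `I(R, y∖s)` summed over the atoms of `y` within `Rm` of `y_j`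
  only (the motif-local test; a finite inequality per `(s, R)`, still quantified over the continuum of competitors `R`);
* §2 ★ `locOpt_of_loc_sharp` — `Sep y`, `Rm ≥ ϱ + D`, `D ≥ 1`: `LocOptLoc μ ε' ϱ Rm K ⟹ LocOpt μ ε ϱ K` whenever `ε' + 2K·T♯(D) ≤ ε`
  (the far atoms change each field by at most `K·T♯(D)`, `T♯ = tailConstSharp`);
* §3 `locOptLoc_transport` — the local test only sees `range y ∩ B̄(y_j, Rm)`: it passes between two configurations whose atoms within `Rm` of the
  two sites are translates of each other;
* §4 ★★ `locOpt_block_of_superMotif_loc` / `nonExempt_block_of_superMotif_loc` — for the cell data of the periodic-block kernels (part B: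
  `PerSep`, dual basis, `cB·(ϱ + diam) < k₀ + 1`, enumeration `(μ, σ)` with centres `cidx`) and `Rm ≤ ϱ`: the motif-local optimality of the class
  centre `cidx m` in the supercell motif gives `LocOpt μ ε ϱ_X K` at EVERY interior site `(m, t)` of EVERY block, for every re-indexing — literally
  the hypothesis `hnex` of `…PeriodicBlockFlagsX` with `Ex := LocOptFails μ ε ϱ_X K`.
All `[folklore]`; 0 sorry.
-/

noncomputable section

namespace Summit.AtomisticToContinuum.Crystallization.Theorems.FrustratedLawDichotomyExemptLocOptLocal

open Metric
open scoped BigOperators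
open Literature.MathematicalPhysics.StatisticalMechanics
open Summit.AtomisticToContinuum.Crystallization.Theorems.ChargedEnergyGapNegative (E3)
open Summit.AtomisticToContinuum.Crystallization.Theorems.FrustratedLawDichotomyExemptDoor (SitePred)
open Summit.AtomisticToContinuum.Crystallization.Theorems.FrustratedLawDichotomyExemptLocOpt (LocOpt LocOptFails tsum_sdiff_split)
open Summit.AtomisticToContinuum.Crystallization.Theorems.FrustratedLawDichotomyExemptLocal (summable_range sep_range)
open Summit.AtomisticToContinuum.Crystallization.Theorems.FrustratedLawDichotomyExemptLocalSharp
  (tailConstSharp tailConstSharp_nonneg abs_fieldEnergy_far_le_sharp)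
open Summit.AtomisticToContinuum.Crystallization.Theorems.FrustratedLawDichotomyRangeCut (Sep)
open Summit.AtomisticToContinuum.Crystallization.Theorems.FrustratedLawDichotomyPeriodicBlockGeometry (latVec sep_reindex range_reindex)
open Summit.AtomisticToContinuum.Crystallization.Theorems.FrustratedLawDichotomyPeriodicBlockKernel

/-! ## §1. The motif-local optimality test -/

/-- **`(ε, ϱ, K)`-LOCAL OPTIMALITY AT `μ`, MOTIF-LOCAL FORM with field radius `Rm`**: the text of `…ExemptLocOpt.LocOpt` with both fields summed over
the atoms of `y` within `Rm` of `y_j` (and off `s`) only. -/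
def LocOptLoc (μ ε ϱ Rm : ℝ) (K : ℕ) : SitePred := fun _ y j =>
  ∀ (a : ℕ) (s : Fin a → EuclideanSpace ℝ (Fin 3)), a ≤ K → Function.Injective s → Set.range s ⊆ Set.range y →
    (∀ l, dist (s l) (y j) ≤ ϱ) →
    ∀ (m : ℕ) (R : Fin m → EuclideanSpace ℝ (Fin 3)), m ≤ K → Function.Injective R → (∀ l, dist (R l) (y j) ≤ ϱ) →
      Disjoint (Set.range R) (Set.range y \ Set.range s) →
        interactionEnergy lennardJones s +
            (∑ i, ∑' q : ↥((Set.range y ∩ closedBall (y j) Rm) \ Set.range s), lennardJones (dist (s i) q)) - μ * a ≤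
          interactionEnergy lennardJones R +
            (∑ i, ∑' q : ↥((Set.range y ∩ closedBall (y j) Rm) \ Set.range s), lennardJones (dist (R i) q)) - μ * m + ε

/-- Loosening the slack keeps the local test. [folklore] -/
theorem LocOptLoc.mono {μ ε ε' ϱ Rm : ℝ} {K : ℕ} (hε : ε' ≤ ε) {N : ℕ} {y : Fin N → E3} {j : Fin N}
    (h : LocOptLoc μ ε' ϱ Rm K N y j) : LocOptLoc μ ε ϱ Rm K N y j :=
  fun a s haK hs hsY hsball m R hmK hR hRball hdisj => (h a s haK hs hsY hsball m R hmK hR hRball hdisj).trans (by linarith)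

/-! ## §2. Local optimality from the motif-local test (sharp tail slack) -/

/-- ★ **`LocOptLoc μ ε' ϱ Rm K ⟹ LocOpt μ ε ϱ K`** for a `7/10`-separated cluster, `Rm ≥ ϱ + D`, `D ≥ 1`, `ε' + 2K·T♯(D) ≤ ε`: the atoms beyond `Rm`
are farther than `D` from every competitor point and change each of the two fields by at most `K·T♯(D)`. [folklore] -/
theorem locOpt_of_loc_sharp {μ ε ε' ϱ Rm D : ℝ} {K : ℕ} (hRm : ϱ + D ≤ Rm) (hD : (1 : ℝ) ≤ D) (hε : ε' + 2 * K * tailConstSharp D ≤ ε)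
    {N : ℕ} {y : Fin N → E3} {j : Fin N} (hsep : Sep y) (h : LocOptLoc μ ε' ϱ Rm K N y j) : LocOpt μ ε ϱ K N y j := by
  intro a s haK hs hsY hsball m R hmK hR hRball hdisj
  have hloc := h a s haK hs hsY hsball m R hmK hR hRball hdisj
  have hD0 : (0 : ℝ) ≤ D := le_trans (by norm_num) hD
  have hAX : Set.range y ∩ closedBall (y j) Rm ⊆ Set.range y := Set.inter_subset_left
  have hSA : Set.range s ⊆ Set.range y ∩ closedBall (y j) Rm := fun q hq => by
    obtain ⟨l, rfl⟩ := hq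
    exact ⟨hsY ⟨l, rfl⟩, mem_closedBall.2 (by linarith [hsball l])⟩
  have hsplit : ∀ (b : ℕ) (x : Fin b → E3),
      (∑ i, ∑' q : ↥(Set.range y \ Set.range s), lennardJones (dist (x i) q)) =
        (∑ i, ∑' q : ↥((Set.range y ∩ closedBall (y j) Rm) \ Set.range s), lennardJones (dist (x i) q)) +
          ∑ i, ∑' q : ↥(Set.range y \ (Set.range y ∩ closedBall (y j) Rm)), lennardJones (dist (x i) q) := by
    intro b x
    rw [← Finset.sum_add_distrib]
    exact Finset.sum_congr rfl fun i _ => tsum_sdiff_split (summable_range y) hAX hSA (x i)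
  have hsepF : ∀ p ∈ Set.range y \ (Set.range y ∩ closedBall (y j) Rm),
      ∀ q ∈ Set.range y \ (Set.range y ∩ closedBall (y j) Rm), p ≠ q → (7 : ℝ) / 10 ≤ dist p q :=
    fun p hp q hq hpq => sep_range hsep p hp.1 q hq.1 hpq
  have hfar : ∀ z : E3, dist z (y j) ≤ ϱ → ∀ q ∈ Set.range y \ (Set.range y ∩ closedBall (y j) Rm), D ≤ dist z q := by
    intro z hz q hq
    have hqR : Rm < dist q (y j) := by
      by_contra hle
      rw [not_lt] at hle
      exact hq.2 ⟨hq.1, mem_closedBall.2 hle⟩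
    have htri : dist q (y j) ≤ dist z q + dist z (y j) := by
      rw [dist_comm z q]; exact dist_triangle q z (y j)
    linarith
  have hfs := abs_fieldEnergy_far_le_sharp hsepF hD s fun i q hq => hfar (s i) (hsball i) q hq
  have hfR := abs_fieldEnergy_far_le_sharp hsepF hD R fun i q hq => hfar (R i) (hRball i) q hq
  have hfs' := le_abs_self (∑ i, ∑' q : ↥(Set.range y \ (Set.range y ∩ closedBall (y j) Rm)), lennardJones (dist (s i) q))
  have hfR' := neg_abs_le (∑ i, ∑' q : ↥(Set.range y \ (Set.range y ∩ closedBall (y j) Rm)), lennardJones (dist (R i) q))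
  have ha : (a : ℝ) ≤ K := by exact_mod_cast haK
  have hm : (m : ℝ) ≤ K := by exact_mod_cast hmK
  have hT0 : 0 ≤ tailConstSharp D := tailConstSharp_nonneg (by linarith)
  have haT : (a : ℝ) * tailConstSharp D ≤ K * tailConstSharp D := mul_le_mul_of_nonneg_right ha hT0
  have hmT : (m : ℝ) * tailConstSharp D ≤ K * tailConstSharp D := mul_le_mul_of_nonneg_right hm hT0
  rw [hsplit a s, hsplit m R]
  linarith

/-! ## §3. The local test only sees the `Rm`-ball: transport between configurations -/

/-- Translating a finite configuration does not change its pair energy. [folklore] -/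
theorem interactionEnergy_sub_const {b : ℕ} (V : ℝ → ℝ) (x : Fin b → E3) (w : E3) :
    interactionEnergy V (fun l => x l - w) = interactionEnergy V x := by
  simp only [interactionEnergy, dist_sub_right]

/-- ★ **TRANSPORT of the motif-local test**: if `y j = z c + w`, every atom of `y` within `Rm` of `y j` is a `w`-translate of an atom of `z`, every atom
of `z` within `Rm` of `z c` translates to an atom of `y`, and `ϱ ≤ Rm`, then `LocOptLoc μ ε ϱ Rm K` passes from `(z, c)` to `(y, j)`. [folklore] -/
theorem locOptLoc_transport {μ ε ϱ Rm : ℝ} {K : ℕ} {M N : ℕ} {z : Fin M → E3} {c : Fin M} {y : Fin N → E3} {j : Fin N} (w : E3)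
    (hj : y j = z c + w) (hϱ : ϱ ≤ Rm)
    (hball : ∀ p ∈ Set.range y, dist p (y j) ≤ Rm → p - w ∈ Set.range z)
    (hmotif : ∀ q ∈ Set.range z, dist q (z c) ≤ Rm → q + w ∈ Set.range y)
    (h : LocOptLoc μ ε ϱ Rm K M z c) : LocOptLoc μ ε ϱ Rm K N y j := by
  intro a s haK hs hsY hsball m R hmK hR hRball hdisj
  have hzc : z c = y j - w := by rw [hj, add_sub_cancel_right]
  have hdist : ∀ p : E3, dist (p - w) (z c) = dist p (y j) := fun p => by rw [hzc, dist_sub_right]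
  have hdist' : ∀ p q : E3, dist (p - w) q = dist p (q + w) := fun p q => by
    rw [← dist_sub_right p (q + w) w, add_sub_cancel_right]
  -- the translated competitors
  have hs'inj : Function.Injective (fun l => s l - w) := fun l l' hl => hs (sub_left_injective hl)
  have hR'inj : Function.Injective (fun l => R l - w) := fun l l' hl => hR (sub_left_injective hl)
  have hs'Y : Set.range (fun l => s l - w) ⊆ Set.range z := by
    rintro _ ⟨l, rfl⟩
    exact hball (s l) (hsY ⟨l, rfl⟩) ((hsball l).trans hϱ)
  have hs'ball : ∀ l, dist (s l - w) (z c) ≤ ϱ := fun l => by rw [hdist]; exact hsball l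
  have hR'ball : ∀ l, dist (R l - w) (z c) ≤ ϱ := fun l => by rw [hdist]; exact hRball l
  have hdisj' : Disjoint (Set.range (fun l => R l - w)) (Set.range z \ Set.range (fun l => s l - w)) := by
    rw [Set.disjoint_left]
    rintro _ ⟨l, rfl⟩ ⟨hq, hqs⟩
    have hqy : R l - w + w ∈ Set.range y := hmotif _ hq ((hR'ball l).trans hϱ)
    rw [sub_add_cancel] at hqy
    have hRl : R l ∈ Set.range y \ Set.range s := by
      refine ⟨hqy, ?_⟩
      rintro ⟨l', hl'⟩
      exact hqs ⟨l', by simp only [hl']⟩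
    exact Set.disjoint_left.1 hdisj ⟨l, rfl⟩ hRl
  have key := h a (fun l => s l - w) haK hs'inj hs'Y hs'ball m (fun l => R l - w) hmK hR'inj hR'ball hdisj'
  -- the two index sets of the local fields are translates of each other
  set A : Set E3 := (Set.range y ∩ closedBall (y j) Rm) \ Set.range s with hA
  set A' : Set E3 := (Set.range z ∩ closedBall (z c) Rm) \ Set.range (fun l => s l - w) with hA'
  have hAA' : A = (fun q => q + w) '' A' := by
    ext p
    constructor
    · rintro ⟨⟨hpy, hpb⟩, hps⟩
      refine ⟨p - w, ⟨⟨hball p hpy (mem_closedBall.1 hpb), mem_closedBall.2 ?_⟩, ?_⟩, sub_add_cancel p w⟩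
      · rw [hdist]; exact mem_closedBall.1 hpb
      · rintro ⟨l, hl⟩
        exact hps ⟨l, sub_left_injective (hl : s l - w = p - w)⟩
    · rintro ⟨q, ⟨⟨hqz, hqb⟩, hqs⟩, rfl⟩
      refine ⟨⟨hmotif q hqz (mem_closedBall.1 hqb), mem_closedBall.2 ?_⟩, ?_⟩
      · rw [← hdist, add_sub_cancel_right]; exact mem_closedBall.1 hqb
      · rintro ⟨l, hl⟩
        exact hqs ⟨l, by simp only [hl, add_sub_cancel_right]⟩
  have hfield : ∀ p : E3, ∑' q : ↥A, lennardJones (dist p q) = ∑' q : ↥A', lennardJones (dist (p - w) q) := by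
    intro p
    let eqv : ↥A' ≃ ↥A := (Equiv.Set.image (fun q => q + w) A' (add_left_injective w)).trans (Equiv.setCongr hAA'.symm)
    rw [← eqv.tsum_eq]
    refine tsum_congr fun q => ?_
    have hq : ((eqv q : ↥A) : E3) = (q : E3) + w := rfl
    rw [hq, hdist']
  have hUs := interactionEnergy_sub_const lennardJones s w
  have hUR := interactionEnergy_sub_const lennardJones R w
  simp only [hUs, hUR, ← hfield] at key
  exact key

/-! ## §4. The interior sites of periodic blocks inherit the motif-local optimality of their class -/

/-- ★★ **LOCAL OPTIMALITY OF INTERIOR BLOCK SITES FROM THE SUPERCELL MOTIF**: with the cell data of the periodic-block kernels (part B) and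
`ϱ_X + D ≤ Rm ≤ ϱ`, `D ≥ 1`, `ε' + 2K·T♯(D) ≤ ε`, the motif-local test `LocOptLoc μ ε' ϱ_X Rm K` at the class centre `cidx m` of the supercell motif
gives `LocOpt μ ε ϱ_X K` at the block site `(m, t)` for every block size, every interior `t` and every re-indexing `e`. [folklore] -/
theorem locOpt_block_of_superMotif_loc {N₀ M k₀ n N : ℕ} {x : Fin N₀ → E3} {a b : Fin 3 → E3} {cB ϱ diam : ℝ} (hsep : PerSep x a)
    (hdual : ∀ j k, inner ℝ (b j) (a k) = if j = k then (1 : ℝ) else 0) (hb : ∀ j, ‖b j‖ ≤ cB) (hdiam : DiamLE x diam)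
    (hk₀ : cB * (ϱ + diam) < k₀ + 1) {μ : Fin M → Fin N₀} {σ : Fin M → Fin 3 → ℤ} (hσ : ∀ q k, |σ q k| ≤ k₀)
    (hsup : ∀ (m : Fin N₀) (s : Fin 3 → ℤ), (∀ k, |s k| ≤ k₀) → ∃ q, μ q = m ∧ σ q = s)
    {cidx : Fin N₀ → Fin M} (hc : ∀ m, μ (cidx m) = m ∧ σ (cidx m) = 0)
    (e : (Fin N₀ × (Fin 3 → Fin n)) ≃ Fin N) {t : Fin 3 → Fin n} (ht : Interior k₀ n t) {m : Fin N₀}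
    {μ₀ ε ε' ϱX Rm D : ℝ} {K : ℕ} (hRm : Rm ≤ ϱ) (hϱX : ϱX + D ≤ Rm) (hD : (1 : ℝ) ≤ D) (hε : ε' + 2 * K * tailConstSharp D ≤ ε)
    (h : LocOptLoc μ₀ ε' ϱX Rm K M (superMotif x a μ σ) (cidx m)) : LocOpt μ₀ ε ϱX K N (block x a n ∘ e.symm) (e (m, t)) := by
  have hYsep : Sep (block x a n ∘ e.symm) := sep_reindex e (block_sep hsep n)
  refine locOpt_of_loc_sharp hϱX hD hε hYsep ?_
  have hsite : (block x a n ∘ e.symm) (e (m, t)) = superMotif x a μ σ (cidx m) + latVec a (tvec t) := by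
    rw [Function.comp_apply, Equiv.symm_apply_apply, superMotif_centre x a hc m t]
  have hsite' : (block x a n ∘ e.symm) (e (m, t)) = x m + latVec a (tvec t) := by
    rw [Function.comp_apply, Equiv.symm_apply_apply]; rfl
  have hD0 : (0 : ℝ) ≤ D := le_trans (by norm_num) hD
  refine locOptLoc_transport (latVec a (tvec t)) hsite (by linarith) ?_ ?_ h
  · intro p hp hpd
    rw [range_reindex] at hp
    obtain ⟨p', rfl⟩ := hp
    rw [hsite'] at hpd
    obtain ⟨q, hq⟩ := mem_range_superMotif_add_of_dist_le (n := n) hdual hb hdiam hk₀ hsup m (hpd.trans hRm)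
    exact ⟨q, by rw [← hq, add_sub_cancel_right]⟩
  · intro q hq _
    obtain ⟨q', rfl⟩ := hq
    rw [range_reindex]
    exact superMotif_add_mem_range_block x a hσ ht q'

/-- ★★ **The X-kernel's non-exemption hypothesis for `Ex := LocOptFails μ ε ϱ_X K`**: motif-local optimality of every class centre ⟹ no interior site of
any block (any size, any re-indexing) fails `(ε, ϱ_X, K)`-local optimality — the binder `hnex` of
`…PeriodicBlockFlagsX.not_schurElasticPricingX_of_cell_strained_nonExempt` / `…_allBad_nonExempt`. [folklore] -/
theorem nonExempt_block_of_superMotif_loc {N₀ M k₀ : ℕ} {x : Fin N₀ → E3} {a b : Fin 3 → E3} {cB ϱ diam : ℝ} (hsep : PerSep x a)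
    (hdual : ∀ j k, inner ℝ (b j) (a k) = if j = k then (1 : ℝ) else 0) (hb : ∀ j, ‖b j‖ ≤ cB) (hdiam : DiamLE x diam)
    (hk₀ : cB * (ϱ + diam) < k₀ + 1) {μ : Fin M → Fin N₀} {σ : Fin M → Fin 3 → ℤ} (hσ : ∀ q k, |σ q k| ≤ k₀)
    (hsup : ∀ (m : Fin N₀) (s : Fin 3 → ℤ), (∀ k, |s k| ≤ k₀) → ∃ q, μ q = m ∧ σ q = s)
    {cidx : Fin N₀ → Fin M} (hc : ∀ m, μ (cidx m) = m ∧ σ (cidx m) = 0)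
    {μ₀ ε ε' ϱX Rm D : ℝ} {K : ℕ} (hRm : Rm ≤ ϱ) (hϱX : ϱX + D ≤ Rm) (hD : (1 : ℝ) ≤ D) (hε : ε' + 2 * K * tailConstSharp D ≤ ε)
    (hall : ∀ m, LocOptLoc μ₀ ε' ϱX Rm K M (superMotif x a μ σ) (cidx m)) :
    ∀ (n N : ℕ) (e : (Fin N₀ × (Fin 3 → Fin n)) ≃ Fin N) (m : Fin N₀) (t : Fin 3 → Fin n), Interior k₀ n t →
      ¬ LocOptFails μ₀ ε ϱX K N (block x a n ∘ e.symm) (e (m, t)) :=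
  fun _ _ e m _ ht hF => hF (locOpt_block_of_superMotif_loc hsep hdual hb hdiam hk₀ hσ hsup hc e ht hRm hϱX hD hε (hall m))

end Summit.AtomisticToContinuum.Crystallization.Theorems.FrustratedLawDichotomyExemptLocOptLocal

end
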